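import Summits.BirchSwinnertonDyer.BirchSwinnertonDyer.Theorems.PrintCFramBottomClassIndexLawFiveLeEisensteinAlgebraicMuRefined
import HarnessLib

/-!
# Route `PrintCFram`, crux C2 `BottomClassIndexLawFiveLe` (stmt-BirchSwinnertonDyer-20372), line `eisenstein-resource-bdp-line`,
# skeleton v3 (critic V#23 hygiene; registered by LEAD g3, sha16 305336f1dc271bb6): by-name sockets for the NEW stub
# `stub_torsion_cmRamified` and for the IsTorsion-guarded v3 form of `stub_invariantMatch_cmRamified`
# (cell `bsd-print-cfram`, seat `bsd-line-cfram-p1` LEAD g3; helper `--supports` 20372; TWO theorems, 0 facts)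

HONEST FRAMING. Nothing about BSD is proved; no stub is closed. (1) `stub_torsion_cmRamified_of_line`: the REGISTERED v3 torsion
stub (signature verbatim) ⟸ per-frame residual line-devissage data (a `Γ_{K''}`-stable line `Φ ≤ W[p]` with
`(W[p]/Φ)^{G_{K''_{∞,𝔭'}}} = 0` and finite residual Selmer groups of `Φ`, `W[p]/Φ` at the bad places prime to `p`), by
`isTorsion_and_mu_eq_zero_of_line_devissage` with Brink discharged (`ZpExtension.not_decomp_le_kerSubgroup_of_isImaginaryQuadratic`).
(2) `stub_invariantMatch_cmRamified_v3_of_v2`: the v3 stub 2 (extra `IsTorsion` hypothesis) ⟸ the v2 form proved from (ALG′) ∧ (AN)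
in the companion (`stub_invariantMatch_cmRamified_of_line_of_analyticInequality`) — the hypothesis is simply dropped. BSD is not proved
by any of this; no summit statement is proved by this seat.

References: Castella–Grossi–Lee–Skinner 2022 §3 [CastellaGrossiLeeSkinner2022]; Greenberg–Vatsal 2000 Prop. (2.8) [GreenbergVatsal2000];
Brink 2007 Thm. 2 [Brink2007].
-/

noncomputable section

open scoped Classical

set_option linter.dupNamespace false
set_option autoImplicit false

namespace Summit.BirchSwinnertonDyer.BirchSwinnertonDyer.Theorems.PrintCFram.EisensteinResourceBdpLine

open WeierstrassCurve NumberField IsDedekindDomain Field PowerSeries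
  Literature.NumberTheory.EllipticCurves Literature.NumberTheory.EllipticCurves.GreenbergSelmer
  Literature.NumberTheory.EllipticCurves.ModularForms Literature.NumberTheory.EllipticCurves.Rank1Residual
  Summit.BirchSwinnertonDyer.BirchSwinnertonDyer.Theorems.SchneiderFree
  Literature.NumberTheory.EllipticCurves.GreenbergVatsal2000
  Literature.NumberTheory.EllipticCurves.IwasawaAlgebra
  Literature.NumberTheory.GaloisRepresentations
  Summit.BirchSwinnertonDyer.Rank1Residual Summit.BirchSwinnertonDyer.Rank1Residual.X11b
  Summit.BirchSwinnertonDyer.Rank1Residual.X11b.AcSelmer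
  Summit.BirchSwinnertonDyer.Rank1Residual.X2.ResidualDevissageModules
  Summit.BirchSwinnertonDyer.BirchSwinnertonDyer.Theorems.CumulativeHeegnerInclusionAtThreeResidualDevissage
  Summit.BirchSwinnertonDyer.BirchSwinnertonDyer.Theorems.UniversalToricDescentAcDualMuZero

/-- **REGISTERED `stub_torsion_cmRamified` (v3, verbatim) ⟸ residual line-devissage data at every frame.** The hypothesis `hlineT`
asks, at each CM-ramified row / Heegner field / anticyclotomic frame `(κ, γ, 𝔭, 𝔭')`, for a `Γ_{K''}`-stable line `Φ ≤ W[p]` with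
`(W[p]/Φ)^{G_{K''_{∞,𝔭'}}} = 0` and FINITE residual Selmer groups of `Φ` and `W[p]/Φ` (strict at `𝔭'`, unramified outside the bad
places prime to `p`; CGLS Prop. 14 shape); conclusion: `X_(∅,0)(W/K''_∞)` is `Λ`-torsion (and in fact `μ = 0`, not recorded by the
stub). CONDITIONAL on `hlineT`; closes nothing. [cite: CastellaGrossiLeeSkinner2022, §3 Props. 14, 17, 18 (arXiv:2008.02571 §1)]
[cite: GreenbergVatsal2000, §2 Prop. (2.8)] -/
theorem stub_torsion_cmRamified_of_line
    (hlineT : ∀ (p : ℕ) [Fact p.Prime] (W : WeierstrassCurve ℚ) [W.IsElliptic] [W.IsGloballyMinimal],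
      W.HasCM → CMRamified W p → 5 ≤ p → W.analyticRank = 1 →
      ∀ (N : ℕ) [NeZero N] (K : Type) [Field K] [NumberField K],
      W.conductorNorm ℤ = N → IsImaginaryQuadratic K → SatisfiesHeegnerHypothesis N K →
      ∀ (κ : ZpExtension K p), κ.IsAnticyclotomic → ∀ (γ : Field.absoluteGaloisGroup K) [Fact (κ.IsTopGenerator γ)]
        (𝔭 : HeightOneSpectrum (𝓞 K)), ((p : ℕ) : 𝓞 K) ∈ 𝔭.asIdeal → 𝔭.asIdeal.ramificationIdx (𝓞 ℚ) = 1 →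
        𝔭.asIdeal.inertiaDeg (𝓞 ℚ) = 1 → ∀ (𝔭' : HeightOneSpectrum (𝓞 K)), ((p : ℕ) : 𝓞 K) ∈ 𝔭'.asIdeal → 𝔭' ≠ 𝔭 →
          ∃ Φ : StableSubgroup (absoluteGaloisGroup K) ((W.baseChange K).geomTorsion (p : ℤ)),
            (∀ y : Φ.Quot, (∀ g : ↥(κ.kerSubgroup ⊓ decomp 𝔭'), g • y = y) → y = 0) ∧
            (datumStrictSelmer κ.kerSubgroup Φ.Sub p (AcSelmer.bdpData Φ.Sub p 𝔭')
                {v : HeightOneSpectrum (𝓞 K) | ¬ (W.baseChange K).HasGoodReductionAt v ∧ ((p : ℕ) : 𝓞 K) ∉ v.asIdeal} :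
              Set (subgroupH1 κ.kerSubgroup Φ.Sub)).Finite ∧
            (datumStrictSelmer κ.kerSubgroup Φ.Quot p (AcSelmer.bdpData Φ.Quot p 𝔭')
                {v : HeightOneSpectrum (𝓞 K) | ¬ (W.baseChange K).HasGoodReductionAt v ∧ ((p : ℕ) : 𝓞 K) ∉ v.asIdeal} :
              Set (subgroupH1 κ.kerSubgroup Φ.Quot)).Finite) :
    ∀ (p : ℕ) [Fact p.Prime] (W : WeierstrassCurve ℚ) [W.IsElliptic] [W.IsGloballyMinimal],
      W.HasCM → CMRamified W p → 5 ≤ p → W.analyticRank = 1 →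
      ∀ (N : ℕ) [NeZero N] (K : Type) [Field K] [NumberField K],
      W.conductorNorm ℤ = N → IsImaginaryQuadratic K → SatisfiesHeegnerHypothesis N K →
      ∀ (κ : ZpExtension K p), κ.IsAnticyclotomic → ∀ (γ : Field.absoluteGaloisGroup K) [Fact (κ.IsTopGenerator γ)]
        (𝔭 : HeightOneSpectrum (𝓞 K)), ((p : ℕ) : 𝓞 K) ∈ 𝔭.asIdeal → 𝔭.asIdeal.ramificationIdx (𝓞 ℚ) = 1 →
        𝔭.asIdeal.inertiaDeg (𝓞 ℚ) = 1 → ∀ (𝔭' : HeightOneSpectrum (𝓞 K)), ((p : ℕ) : 𝓞 K) ∈ 𝔭'.asIdeal → 𝔭' ≠ 𝔭 →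
        Module.IsTorsion (IwasawaAlgebra p) (XAc (W.baseChange K) p κ 𝔭' ∅ γ) := by
  intro p _ W _ _ hCM hram h5 hr N _ K _ _ hN hK hHN κ hκ γ _ 𝔭 h𝔭 he hf 𝔭' h𝔭' hne
  obtain ⟨Φ, hfix, hΦ, hΨ⟩ := hlineT p W hCM hram h5 hr N K hN hK hHN κ hκ γ 𝔭 h𝔭 he hf 𝔭' h𝔭' hne
  haveI : (W.baseChange K).IsElliptic := by rw [WeierstrassCurve.baseChange]; infer_instance
  exact (isTorsion_and_mu_eq_zero_of_line_devissage (W.baseChange K) κ 𝔭' γ h𝔭'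
    (ZpExtension.not_decomp_le_kerSubgroup_of_isImaginaryQuadratic hK κ (by exact_mod_cast h𝔭'))
    (S := {v : HeightOneSpectrum (𝓞 K) | ¬ (W.baseChange K).HasGoodReductionAt v ∧ ((p : ℕ) : 𝓞 K) ∉ v.asIdeal})
    (fun v hv hpv => by
      by_contra hbad
      exact hv ⟨hbad, hpv⟩) Φ hfix hΦ hΨ).1

/-- **REGISTERED `stub_invariantMatch_cmRamified` of v3 (with its `IsTorsion` guard, verbatim) ⟸ the v2 form** (no guard), hence ⟸
(ALG′) ∧ (AN) by the companion's `stub_invariantMatch_cmRamified_of_line_of_analyticInequality`. [cite: CastellaGrossiLeeSkinner2022, Thm. 3.2.1 (arXiv:2008.02571 p. 4)] -/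
theorem stub_invariantMatch_cmRamified_v3_of_v2
    (h2 : ∀ (p : ℕ) [Fact p.Prime] (W : WeierstrassCurve ℚ) [W.IsElliptic] [W.IsGloballyMinimal],
      W.HasCM → CMRamified W p → 5 ≤ p → W.analyticRank = 1 →
      ∀ (N : ℕ) [NeZero N] (K : Type) [Field K] [NumberField K] (Dt : ModularParametrizationData W N),
      W.conductorNorm ℤ = N → IsImaginaryQuadratic K → SatisfiesHeegnerHypothesis N K →
      ∀ (κ : ZpExtension K p), κ.IsAnticyclotomic → ∀ (γ : Field.absoluteGaloisGroup K) [Fact (κ.IsTopGenerator γ)]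
        (𝔭 : HeightOneSpectrum (𝓞 K)), ((p : ℕ) : 𝓞 K) ∈ 𝔭.asIdeal → 𝔭.asIdeal.ramificationIdx (𝓞 ℚ) = 1 →
        𝔭.asIdeal.inertiaDeg (𝓞 ℚ) = 1 → ∀ (𝔭' : HeightOneSpectrum (𝓞 K)), ((p : ℕ) : 𝓞 K) ∈ 𝔭'.asIdeal → 𝔭' ≠ 𝔭 →
        ∀ (ι' : PadicAlgCl p ≃+* ℂ), SchneiderFree.BranchInducesPrime p ι' 𝔭 →
        ∀ (ΩK : ℂ) (Ωp : ℂ_[p]) (Q : PowerSeries (PadicComplexInt p)), ΩK ≠ 0 → Ωp ≠ 0 →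
          R1.IsBDPLFunctionInt p ι' 𝔭 κ γ Dt.f ΩK Ωp Q →
          ∃ n : ℕ, (∀ m < n, ‖((PowerSeries.coeff m Q : 𝓞_ℂ_[p]) : ℂ_[p])‖ < 1) ∧
            ∃ G ∈ (XAc.charIdeal (W.baseChange K) p κ 𝔭' ∅ γ).map (PowerSeries.map (R1.toCpInt p)),
              ‖((PowerSeries.coeff n G : 𝓞_ℂ_[p]) : ℂ_[p])‖ = 1) :
    ∀ (p : ℕ) [Fact p.Prime] (W : WeierstrassCurve ℚ) [W.IsElliptic] [W.IsGloballyMinimal],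
      W.HasCM → CMRamified W p → 5 ≤ p → W.analyticRank = 1 →
      ∀ (N : ℕ) [NeZero N] (K : Type) [Field K] [NumberField K] (Dt : ModularParametrizationData W N),
      W.conductorNorm ℤ = N → IsImaginaryQuadratic K → SatisfiesHeegnerHypothesis N K →
      ∀ (κ : ZpExtension K p), κ.IsAnticyclotomic → ∀ (γ : Field.absoluteGaloisGroup K) [Fact (κ.IsTopGenerator γ)]
        (𝔭 : HeightOneSpectrum (𝓞 K)), ((p : ℕ) : 𝓞 K) ∈ 𝔭.asIdeal → 𝔭.asIdeal.ramificationIdx (𝓞 ℚ) = 1 →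
        𝔭.asIdeal.inertiaDeg (𝓞 ℚ) = 1 → ∀ (𝔭' : HeightOneSpectrum (𝓞 K)), ((p : ℕ) : 𝓞 K) ∈ 𝔭'.asIdeal → 𝔭' ≠ 𝔭 →
        ∀ (ι' : PadicAlgCl p ≃+* ℂ), SchneiderFree.BranchInducesPrime p ι' 𝔭 →
        ∀ (ΩK : ℂ) (Ωp : ℂ_[p]) (Q : PowerSeries (PadicComplexInt p)), ΩK ≠ 0 → Ωp ≠ 0 →
          R1.IsBDPLFunctionInt p ι' 𝔭 κ γ Dt.f ΩK Ωp Q →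
          Module.IsTorsion (IwasawaAlgebra p) (XAc (W.baseChange K) p κ 𝔭' ∅ γ) →
          ∃ n : ℕ, (∀ m < n, ‖((PowerSeries.coeff m Q : 𝓞_ℂ_[p]) : ℂ_[p])‖ < 1) ∧
            ∃ G ∈ (XAc.charIdeal (W.baseChange K) p κ 𝔭' ∅ γ).map (PowerSeries.map (R1.toCpInt p)),
              ‖((PowerSeries.coeff n G : 𝓞_ℂ_[p]) : ℂ_[p])‖ = 1 := by
  intro p _ W _ _ hCM hram h5 hr N _ K _ _ Dt hN hK hHN κ hκ γ _ 𝔭 h𝔭 he hf 𝔭' h𝔭' hne ι' hind ΩK Ωp Q hΩK hΩp hBDP _htors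
  exact h2 p W hCM hram h5 hr N K Dt hN hK hHN κ hκ γ 𝔭 h𝔭 he hf 𝔭' h𝔭' hne ι' hind ΩK Ωp Q hΩK hΩp hBDP

end Summit.BirchSwinnertonDyer.BirchSwinnertonDyer.Theorems.PrintCFram.EisensteinResourceBdpLine

end
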